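import Mathlib
import Literature.NumberTheory.EllipticCurves.TwoIsogenySelmerGroupRankProofs

/-!
# Rank-2 observatory — KERNEL-ISO bookkeeping (C1): the rank upper bound from explicit supersets of the
# two `2`-isogeny Selmer sets

HONEST FRAMING: per-curve certified theorems and census instruments; no claim on BSD in rank ≥ 2.

For `E_{a,b} : y² = x³ + a x² + b x` (`b (a² - 4b) ≠ 0`) the Literature proves
`rank E_{a,b}(ℚ) + 2 ≤ dim₂ S(a, b) + dim₂ S(-2a, a² - 4b)` (`twoIsogeny_mordellWeilRank_add_two_le_holds`,
Silverman–Tate Prop. 3.8 / *AEC* X.4.9), where `S(a, b) = twoIsogenySelmerGroup a b` is the finite set of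
squarefree `d ∣ b` whose homogeneous space `w² = d u⁴ + a u²z² + (b/d) z⁴` is everywhere locally soluble.
This file turns that into a per-curve instrument:

* `sqfreeProds l` — the products of sub-lists of a list of primes; `mem_signed_sqfreeProds`: every squarefree
  divisor `d` of `b` is `± n` with `n ∈ sqfreeProds l` as soon as `l` contains every prime factor of `b`
  (per curve: `b.natAbs.primeFactorsList = l` by `simp`, primes certified by the `Nat.primeFactorsList`
  simproc);
* `twoIsogenySelmerGroup_subset`: if every candidate `± n` outside an explicit finset `D` has a NON-locally-soluble
  space (killed over `ℝ` by the Literature sign lemmas or over some `ℚ_p` by the reflective search of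
  `Rank2ObservatoryIsoLocalCheck`/`…Bridge`), then `S(a, b) ⊆ D`;
* `mordellWeilRank_le_of_selmer_subsets`: `S(a,b) ⊆ D₁`, `S(-2a, a²-4b) ⊆ D₂`,
  `log₂ #D₁ + log₂ #D₂ ≤ s + 2` ⇒ `rank ≤ s`.

## References
* J. H. Silverman, J. Tate, *Rational Points on Elliptic Curves*, 2nd ed. (2015), §3.6 and Prop. 3.8.
  [cite: SilvermanTate2015, §3.6]
* J. E. Cremona, *Algorithms for Modular Elliptic Curves*, 2nd ed. (1997), §3.6, Method 1 (descent using
  2-isogeny: `n₁`, `n₂` and `rank = log₂(n₁ n₂ / 4)`). [cite: CremonaAlgorithms1997, §3.6 (Method 1)]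
-/

set_option linter.dupNamespace false

namespace Summit.BirchSwinnertonDyer.BirchSwinnertonDyer.Rank2Observatory.IsoLocal

open Literature.NumberTheory.EllipticCurves

/-- The products of sub-lists of `l` (for a list of distinct primes: the positive squarefree numbers they
generate). [folklore] -/
def sqfreeProds : List ℕ → List ℕ
  | [] => [1]
  | p :: l => sqfreeProds l ++ (sqfreeProds l).map (p * ·)

/-- A squarefree natural number all of whose prime factors lie in `l` is in `sqfreeProds l`. [folklore] -/
theorem mem_sqfreeProds : ∀ (l : List ℕ) {n : ℕ}, Squarefree n →
    (∀ q : ℕ, q.Prime → q ∣ n → q ∈ l) → n ∈ sqfreeProds l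
  | [], n, hsq, hq => by
      have hn1 : n = 1 := by
        by_contra h
        obtain ⟨q, hq', hqn⟩ := Nat.exists_prime_and_dvd h
        simpa using hq q hq' hqn
      simp [sqfreeProds, hn1]
  | p :: l, n, hsq, hq => by
      simp only [sqfreeProds, List.mem_append, List.mem_map]
      by_cases hpn : p ∣ n
      · right
        obtain ⟨n', rfl⟩ := hpn
        refine ⟨n', mem_sqfreeProds l (Squarefree.of_mul_right hsq) (fun q hq' hqn' => ?_), rfl⟩
        rcases List.mem_cons.mp (hq q hq' (Dvd.dvd.mul_left hqn' p)) with rfl | h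
        · exfalso
          have hu : IsUnit q := hsq q (mul_dvd_mul_left q hqn')
          exact hq'.ne_one (Nat.isUnit_iff.mp hu)
        · exact h
      · left
        refine mem_sqfreeProds l hsq (fun q hq' hqn => ?_)
        rcases List.mem_cons.mp (hq q hq' hqn) with rfl | h
        · exact absurd hqn hpn
        · exact h

/-- The signed candidate list `± sqfreeProds l`. [folklore] -/
def signedSqfreeProds (l : List ℕ) : List ℤ :=
  (sqfreeProds l).map (fun n : ℕ => (n : ℤ)) ++ (sqfreeProds l).map (fun n : ℕ => -(n : ℤ))

/-- Every squarefree divisor of `b` is in the signed candidate list, provided `l` contains all prime factors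
of `b`. [folklore] -/
theorem mem_signedSqfreeProds {b d : ℤ} (l : List ℕ) (hl : ∀ q : ℕ, q.Prime → q ∣ b.natAbs → q ∈ l)
    (hsq : Squarefree d) (hdb : d ∣ b) : d ∈ signedSqfreeProds l := by
  have h : d.natAbs ∈ sqfreeProds l :=
    mem_sqfreeProds l (Int.squarefree_natAbs.mpr hsq)
      (fun q hq hqd => hl q hq (hqd.trans (Int.natAbs_dvd_natAbs.mpr hdb)))
  unfold signedSqfreeProds
  rcases Int.natAbs_eq d with hd | hd
  · exact List.mem_append_left _ (List.mem_map.mpr ⟨_, h, hd.symm⟩)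
  · exact List.mem_append_right _ (List.mem_map.mpr ⟨_, h, hd.symm⟩)

/-- Reading the prime factors off `Nat.primeFactorsList` (computed per curve by the `simp` simproc).
[folklore] -/
theorem primes_mem_of_primeFactorsList_eq {N : ℕ} (hN : N ≠ 0) {l : List ℕ}
    (h : N.primeFactorsList = l) (q : ℕ) (hq : q.Prime) (hqN : q ∣ N) : q ∈ l := by
  rw [← h]
  exact (Nat.mem_primeFactorsList hN).mpr ⟨hq, hqN⟩

/-- **`S(a, b) ⊆ D`** once every signed candidate outside `D` is killed (not locally soluble).
[cite: SilvermanTate2015, §3.6] -/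
theorem twoIsogenySelmerGroup_subset {a b : ℤ} (hb : b ≠ 0) (l : List ℕ)
    (hl : ∀ q : ℕ, q.Prime → q ∣ b.natAbs → q ∈ l) (D : Finset ℤ)
    (hkill : ∀ d ∈ signedSqfreeProds l, d ∉ D → ¬ (twoIsogenyQuartic a d (b / d)).IsLocallySoluble) :
    twoIsogenySelmerGroup a b ⊆ D := by
  intro d hd
  rw [mem_twoIsogenySelmerGroup_iff hb] at hd
  obtain ⟨hsq, hdb, hls⟩ := hd
  by_contra hD
  exact hkill d (mem_signedSqfreeProds l hl hsq hdb) hD hls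

/-- **The rank upper bound from Selmer supersets**: `S(a,b) ⊆ D₁`, `S(-2a, a² - 4b) ⊆ D₂` and
`log₂ #D₁ + log₂ #D₂ ≤ s + 2` give `rank E_{a,b}(ℚ) ≤ s`. [cite: SilvermanTate2015, §3.6] -/
theorem mordellWeilRank_le_of_selmer_subsets {a b : ℤ} (hab : b * (a ^ 2 - 4 * b) ≠ 0) {D₁ D₂ : Finset ℤ}
    (h₁ : twoIsogenySelmerGroup a b ⊆ D₁) (h₂ : twoIsogenySelmerGroup (-2 * a) (a ^ 2 - 4 * b) ⊆ D₂)
    {s : ℕ} (hs : Nat.log 2 D₁.card + Nat.log 2 D₂.card ≤ s + 2) :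
    (⟨0, (a : ℚ), 0, (b : ℚ), 0⟩ : WeierstrassCurve ℚ).mordellWeilRank ≤ s := by
  have h := twoIsogeny_mordellWeilRank_add_two_le_holds
  unfold twoIsogeny_mordellWeilRank_add_two_le at h
  specialize h a b hab
  unfold twoIsogenySelmerRank' twoIsogenySelmerRank at h
  have e1 : Nat.log 2 (twoIsogenySelmerGroup a b).card ≤ Nat.log 2 D₁.card :=
    Nat.log_mono_right (Finset.card_le_card h₁)
  have e2 : Nat.log 2 (twoIsogenySelmerGroup (-2 * a) (a ^ 2 - 4 * b)).card ≤ Nat.log 2 D₂.card :=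
    Nat.log_mono_right (Finset.card_le_card h₂)
  omega

/-! ### Sanity checks of the computable side -/

/-- `sqfreeProds [2, 3] = [1, 3, 2, 6]`. [folklore] -/
example : sqfreeProds [2, 3] = [1, 3, 2, 6] := by decide

/-- The simproc evaluates `Nat.primeFactorsList` on census-sized `b` (here `b = 5 · 15223013 = 76115065 =
5 · 13⁵ · 41`, from row `26650k1`). [folklore] -/
example : (76115065 : ℕ).primeFactorsList = [5, 13, 13, 13, 13, 13, 41] := by simp

end Summit.BirchSwinnertonDyer.BirchSwinnertonDyer.Rank2Observatory.IsoLocal
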